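import Summits.BirchSwinnertonDyer.BirchSwinnertonDyer.Theorems.ByReductionTypeAtTwoFineSelmerConjAAtTwoAdditivePotGoodMinkowskiDoor
import HarnessLib

/-!
# Route `ByReductionTypeAtTwo` (rung K4), crux C1″ `FineSelmerConjAAtTwoAdditivePotGood` (item stmt-BirchSwinnertonDyer-22615):
# CENSUS NO-BIT STAMPS — two census curves whose `2`-torsion cubic field is one of the six kernel-settled fields:
# `97712e1` (`d = −31`) and `242704p1` (`d = −44`) satisfy (A)₂ modulo Lim 2017 Thm. 3.5 ALONE, NO displayed datum
# (a `--supports 22615` file; seat `bsd-2adic-k4-w1` GEN 4; upgrades two of the 14 one-bit door stamps of `…CensusDoorStamps{A,B}`)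

HONEST FRAMING (cell `bsd-2adic`, D-0036/D-0054): per-class; conditional on `hLim2` BY NAME and NOTHING ELSE (no certificate, no class-group
datum, no parity bit); closes nothing at the `∀`-level; nothing booked; BSD is not proved by any of this.

MECHANISM (kernel). The census records `d(F_W) = −31` for `97712e1` and `−44` for `242704p1`; `…MinkowskiDoor` proves `h = 1` for
`ℚ(θ)` with `θ³ + θ = 1` (`2` inert) and for `ℚ(θ)` with `θ³ + 2θ² + 2θ + 2 = 0` (Eisenstein, constant term `2`). It remains to IDENTIFY
`ℚ(β)` (`β` a root of the row's `2`-division cubic, `ℚ(P) = ℚ(β)` by `…CubicRealization`) with `ℚ(θ)` INSIDE `ℚ̄`: we exhibit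
`θ = A + Bβ + Cβ² ∈ ℚ(β)` satisfying the small cubic and the inverse `β = a + bθ + cθ²` (integer `a, b, c`: `β ∈ ℤ[θ] = 𝓞`), both as
`linear_combination`s of the `2`-division relation — the coefficients were found numerically (three embeddings, 80 digits) and are
verified here exactly by the kernel. Then `…InertDoor`/`…EisensteinDoor`'s point-field doors with `hF : ℚ(P) = ℚ(θ)` and the kernel
class number.

* `conjA_two_97712e1` — `θ = (8386577256 + 2803909β − 1873β²)/197`, `θ³ + θ − 1 = 0`, `β = 1249 + 1278θ + 1873θ²`.
* `conjA_two_242704p1` — `θ = (−6256540 + 5798994β − 4489β²)/96952087078`, `θ³ + 2θ² + 2θ + 2 = 0`, `β = 3224 + 4836θ + 4489θ²`.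

References: [Lim2017FineSelmer] Thm. 3.5, Lemma 3.2; [CoatesSujatha2005] (A); [Greenberg2001IwasawaPastPresent] Prop. 2.1; [Cohen1993] App. B
Table B.4 (d = −31, −44: h = 1), §4.4 (polynomial reduction); cell file `addL2x/gen5/conjA2_census_j289938_classes.tsv` (column dF3).
-/

set_option autoImplicit false
-- sibling precedent (`…MinkowskiDoor.lean`): the directory name repeats the summit name
set_option linter.dupNamespace false

noncomputable section

open scoped Classical IntermediateField NumberField

namespace Summit.BirchSwinnertonDyer.BirchSwinnertonDyer.Theorems.AddKatoTwo

open WeierstrassCurve Field Polynomial IsDedekindDomain Literature.NumberTheory.EllipticCurves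
  Literature.NumberTheory.GaloisRepresentations
  Literature.NumberTheory.IwasawaTheory
  Summit.BirchSwinnertonDyer.BirchSwinnertonDyer.Theorems.AlignedTransportAtTwoTorsionPointField
  Summit.BirchSwinnertonDyer.BirchSwinnertonDyer.Theses.ByReductionTypeAtTwo

/-- **(A)₂ for the census curve `97712e1` modulo Lim 2017 Thm. 3.5 ALONE — NO displayed datum.** Its `2`-torsion cubic field is
the field of discriminant `−31` (`2` inert, `h = 1` BY THE KERNEL, `…CubicDiscriminant`/`…MinkowskiDoor`): the element
`θ = 8386577256/197 + (2803909/197)·β + (-1873/197)·β²` of `ℚ(β)` is a root of `X³ + (0)X² + (1)X + (-1)` and `β = 1249 + 1278·θ + 1873·θ²`,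
so `ℚ(P) = ℚ(β) = ℚ(θ)` (both identities are `linear_combination`s of the `2`-division relation; coefficients found numerically, checked
exactly). This UPGRADES the one-bit stamp `conjA_two_97712e1_of_oddClassNumber`. [cite: Lim2017FineSelmer, §3 Thm. 3.5 and Lemma 3.2]
[cite: Greenberg2001IwasawaPastPresent, Prop. 2.1 p. 339] [cite: Cohen1993, App. B Table B.4 (d = −31)] -/
theorem conjA_two_97712e1
    (hLim2 : Lim2017.thm35_at_two_fineSelmerDual_moduleFinite_of_classicalMuVanishes_of_le_divisionField_four)
    (κ : ZpExtension ℚ 2) (hκ : κ.IsCyclotomic) :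
    haveI := (isElliptic_cubicModel _ _ _ (by simp only [Cubic.discr]; norm_num) : (⟨0, ((-1 : ℤ) : ℚ), 0, ((-6717174 : ℤ) : ℚ), ((-6698582353 : ℤ) : ℚ)⟩ : WeierstrassCurve ℚ).IsElliptic)
    ∃ (γ : absoluteGaloisGroup ℚ) (D : (⟨0, ((-1 : ℤ) : ℚ), 0, ((-6717174 : ℤ) : ℚ), ((-6698582353 : ℤ) : ℚ)⟩ : WeierstrassCurve ℚ).FineSelmerDualData κ γ),
      Module.Finite ℤ_[2] (RestrictScalars ℤ_[2] (IwasawaAlgebra 2) D.X) := by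
  haveI := (isElliptic_cubicModel _ _ _ (by simp only [Cubic.discr]; norm_num) : (⟨0, ((-1 : ℤ) : ℚ), 0, ((-6717174 : ℤ) : ℚ), ((-6698582353 : ℤ) : ℚ)⟩ : WeierstrassCurve ℚ).IsElliptic)
  obtain ⟨β, hβ⟩ : ∃ β : AlgebraicClosure ℚ, aeval β (Cubic.toPoly ⟨1, ((-1 : ℤ) : ℚ), ((-6717174 : ℤ) : ℚ), ((-6698582353 : ℤ) : ℚ)⟩) = 0 :=
    IsAlgClosed.exists_aeval_eq_zero _ _ (by rw [Cubic.degree_of_a_ne_zero one_ne_zero]; norm_num)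
  have hβ' : β ^ 3 + (-1 : AlgebraicClosure ℚ) * β ^ 2 + (-6717174 : AlgebraicClosure ℚ) * β + (-6698582353 : AlgebraicClosure ℚ) = 0 := by
    have := hβ
    simp only [Cubic.toPoly, map_one, one_mul, aeval_add, aeval_mul, aeval_C, aeval_X_pow, aeval_X,
      eq_ratCast, Rat.cast_intCast] at this
    push_cast at this
    linear_combination this
  set θ : AlgebraicClosure ℚ := algebraMap ℚ (AlgebraicClosure ℚ) (8386577256 / 197 : ℚ) +
      algebraMap ℚ (AlgebraicClosure ℚ) (2803909 / 197 : ℚ) * β + algebraMap ℚ (AlgebraicClosure ℚ) (-1873 / 197 : ℚ) * β ^ 2 with hθdef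
  have hθ : aeval θ (Cubic.toPoly ⟨1, ((0 : ℤ) : ℚ), ((1 : ℤ) : ℚ), ((-1 : ℤ) : ℚ)⟩) = 0 := by
    simp only [Cubic.toPoly, map_one, one_mul, aeval_add, aeval_mul, aeval_C, aeval_X_pow, aeval_X, eq_ratCast,
      Rat.cast_intCast]
    rw [hθdef]
    simp only [eq_ratCast]
    push_cast
    linear_combination (((-88058514523293391099 : AlgebraicClosure ℚ) / 7645373) + ((-19667792900059 : AlgebraicClosure ℚ) / 7645373) * β + ((29502852703166 : AlgebraicClosure ℚ) / 7645373) * β ^ 2 + ((-6570725617 : AlgebraicClosure ℚ) / 7645373) * β ^ 3) * hβ'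
  have hadj : IntermediateField.adjoin ℚ {θ} = IntermediateField.adjoin ℚ {β} := by
    apply le_antisymm
    · rw [IntermediateField.adjoin_simple_le_iff, hθdef]
      have hβmem := IntermediateField.mem_adjoin_simple_self ℚ β
      exact add_mem (add_mem (algebraMap_mem _ _) (mul_mem (algebraMap_mem _ _) hβmem))
        (mul_mem (algebraMap_mem _ _) (pow_mem hβmem 2))
    · rw [IntermediateField.adjoin_simple_le_iff]
      have hβeq : β = algebraMap ℚ (AlgebraicClosure ℚ) (1249 : ℚ) + algebraMap ℚ (AlgebraicClosure ℚ) (1278 : ℚ) * θ +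
          algebraMap ℚ (AlgebraicClosure ℚ) (1873 : ℚ) * θ ^ 2 := by
        rw [hθdef]; simp only [eq_ratCast]; push_cast; linear_combination (((19666378226905 : AlgebraicClosure ℚ) / 38809) + ((-6570725617 : AlgebraicClosure ℚ) / 38809) * β) * hβ'
      rw [hβeq]
      have hθmem := IntermediateField.mem_adjoin_simple_self ℚ θ
      exact add_mem (add_mem (algebraMap_mem _ _) (mul_mem (algebraMap_mem _ _) hθmem))
        (mul_mem (algebraMap_mem _ _) (pow_mem hθmem 2))
  obtain ⟨P₀, hP₀, hP₀eq⟩ := exists_geomTorsion_two_eq_some_root ((-1 : ℤ) : ℚ) ((-6717174 : ℤ) : ℚ) ((-6698582353 : ℤ) : ℚ) hβ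
  have hF : IntermediateField.fixedField (MulAction.stabilizer (absoluteGaloisGroup ℚ) P₀) =
      IntermediateField.adjoin ℚ {θ} := by
    rw [fixedField_stabilizer_eq_adjoin_root _ _ _ hβ hP₀eq, hadj]
    -- the two `Algebra ℚ ℚ̄` instance paths agree
    congr 1
  exact fineSelmerDual_moduleFinite_two_of_odd_cubic_pointField hLim2 _ hP₀ (p := 0) (q := 1) (r := -1) (by decide) (by decide)
    hθ hF (by rw [card_classGroup_adjoin_eq_one_of_odd_of_abs_discr_le (p := 0) (q := 1) (r := -1) (by decide) (by decide)
      (by simp only [Cubic.discr]; norm_num) hθ]; norm_num) κ hκ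

/-- **(A)₂ for the census curve `242704p1` modulo Lim 2017 Thm. 3.5 ALONE — NO displayed datum.** Its `2`-torsion cubic field is
the field of discriminant `−44` (`2 = 𝔭³`, `h = 1` BY THE KERNEL, `…CubicDiscriminant`/`…MinkowskiDoor`): the element
`θ = -3128270/48476043539 + (2899497/48476043539)·β + (-4489/96952087078)·β²` of `ℚ(β)` is a root of `X³ + (2)X² + (2)X + (2)` and `β = 3224 + 4836·θ + 4489·θ²`,
so `ℚ(P) = ℚ(β) = ℚ(θ)` (both identities are `linear_combination`s of the `2`-division relation; coefficients found numerically, checked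
exactly). This UPGRADES the one-bit stamp `conjA_two_242704p1_of_oddClassNumber`. [cite: Lim2017FineSelmer, §3 Thm. 3.5 and Lemma 3.2]
[cite: Greenberg2001IwasawaPastPresent, Prop. 2.1 p. 339] [cite: Cohen1993, App. B Table B.4 (d = −44)] -/
theorem conjA_two_242704p1
    (hLim2 : Lim2017.thm35_at_two_fineSelmerDual_moduleFinite_of_classicalMuVanishes_of_le_divisionField_four)
    (κ : ZpExtension ℚ 2) (hκ : κ.IsCyclotomic) :
    haveI := (isElliptic_cubicModel _ _ _ (by simp only [Cubic.discr]; norm_num) : (⟨0, ((0 : ℤ) : ℚ), 0, ((-21595612 : ℤ) : ℚ), ((-129653860852 : ℤ) : ℚ)⟩ : WeierstrassCurve ℚ).IsElliptic)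
    ∃ (γ : absoluteGaloisGroup ℚ) (D : (⟨0, ((0 : ℤ) : ℚ), 0, ((-21595612 : ℤ) : ℚ), ((-129653860852 : ℤ) : ℚ)⟩ : WeierstrassCurve ℚ).FineSelmerDualData κ γ),
      Module.Finite ℤ_[2] (RestrictScalars ℤ_[2] (IwasawaAlgebra 2) D.X) := by
  haveI := (isElliptic_cubicModel _ _ _ (by simp only [Cubic.discr]; norm_num) : (⟨0, ((0 : ℤ) : ℚ), 0, ((-21595612 : ℤ) : ℚ), ((-129653860852 : ℤ) : ℚ)⟩ : WeierstrassCurve ℚ).IsElliptic)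
  obtain ⟨β, hβ⟩ : ∃ β : AlgebraicClosure ℚ, aeval β (Cubic.toPoly ⟨1, ((0 : ℤ) : ℚ), ((-21595612 : ℤ) : ℚ), ((-129653860852 : ℤ) : ℚ)⟩) = 0 :=
    IsAlgClosed.exists_aeval_eq_zero _ _ (by rw [Cubic.degree_of_a_ne_zero one_ne_zero]; norm_num)
  have hβ' : β ^ 3 + (0 : AlgebraicClosure ℚ) * β ^ 2 + (-21595612 : AlgebraicClosure ℚ) * β + (-129653860852 : AlgebraicClosure ℚ) = 0 := by
    have := hβ
    simp only [Cubic.toPoly, map_one, one_mul, aeval_add, aeval_mul, aeval_C, aeval_X_pow, aeval_X,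
      eq_ratCast, Rat.cast_intCast] at this
    push_cast at this
    linear_combination this
  set θ : AlgebraicClosure ℚ := algebraMap ℚ (AlgebraicClosure ℚ) (-3128270 / 48476043539 : ℚ) +
      algebraMap ℚ (AlgebraicClosure ℚ) (2899497 / 48476043539 : ℚ) * β + algebraMap ℚ (AlgebraicClosure ℚ) (-4489 / 96952087078 : ℚ) * β ^ 2 with hθdef
  have hθ : aeval θ (Cubic.toPoly ⟨1, ((2 : ℤ) : ℚ), ((2 : ℤ) : ℚ), ((2 : ℤ) : ℚ)⟩) = 0 := by
    simp only [Cubic.toPoly, map_one, one_mul, aeval_add, aeval_mul, aeval_C, aeval_X_pow, aeval_X, eq_ratCast,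
      Rat.cast_intCast]
    rw [hθdef]
    simp only [eq_ratCast]
    push_cast
    linear_combination (((-3514212450123258329473 : AlgebraicClosure ℚ) / 227830307468577578531868909599638) + ((3869518 : AlgebraicClosure ℚ) / 2349926797195023644521) * β + ((175284344658411 : AlgebraicClosure ℚ) / 455660614937155157063737819199276) * β ^ 2 + ((-90458382169 : AlgebraicClosure ℚ) / 911321229874310314127475638398552) * β ^ 3) * hβ'
  have hadj : IntermediateField.adjoin ℚ {θ} = IntermediateField.adjoin ℚ {β} := by
    apply le_antisymm
    · rw [IntermediateField.adjoin_simple_le_iff, hθdef]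
      have hβmem := IntermediateField.mem_adjoin_simple_self ℚ β
      exact add_mem (add_mem (algebraMap_mem _ _) (mul_mem (algebraMap_mem _ _) hβmem))
        (mul_mem (algebraMap_mem _ _) (pow_mem hβmem 2))
    · rw [IntermediateField.adjoin_simple_le_iff]
      have hβeq : β = algebraMap ℚ (AlgebraicClosure ℚ) (3224 : ℚ) + algebraMap ℚ (AlgebraicClosure ℚ) (4836 : ℚ) * θ +
          algebraMap ℚ (AlgebraicClosure ℚ) (4489 : ℚ) * θ ^ 2 := by
        rw [hθdef]; simp only [eq_ratCast]; push_cast; linear_combination (((58428114886137 : AlgebraicClosure ℚ) / 2349926797195023644521) + ((-90458382169 : AlgebraicClosure ℚ) / 9399707188780094578084) * β) * hβ'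
      rw [hβeq]
      have hθmem := IntermediateField.mem_adjoin_simple_self ℚ θ
      exact add_mem (add_mem (algebraMap_mem _ _) (mul_mem (algebraMap_mem _ _) hθmem))
        (mul_mem (algebraMap_mem _ _) (pow_mem hθmem 2))
  obtain ⟨P₀, hP₀, hP₀eq⟩ := exists_geomTorsion_two_eq_some_root ((0 : ℤ) : ℚ) ((-21595612 : ℤ) : ℚ) ((-129653860852 : ℤ) : ℚ) hβ
  have hF : IntermediateField.fixedField (MulAction.stabilizer (absoluteGaloisGroup ℚ) P₀) =
      IntermediateField.adjoin ℚ {θ} := by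
    rw [fixedField_stabilizer_eq_adjoin_root _ _ _ hβ hP₀eq, hadj]
    -- the two `Algebra ℚ ℚ̄` instance paths agree
    congr 1
  exact fineSelmerDual_moduleFinite_two_of_eisenstein_pointField hLim2 _ hP₀ (p := 2) (q := 2) (r := 2) (by decide) (by decide)
    (by decide) (by decide) hθ hF (by rw [card_classGroup_adjoin_eq_one_of_eisenstein_two_of_abs_discr_le (p := 2) (q := 2)
      (r := 2) (by decide) (by decide) (Or.inl rfl) (by simp only [Cubic.discr]; norm_num) hθ]; norm_num) κ hκ

end Summit.BirchSwinnertonDyer.BirchSwinnertonDyer.Theorems.AddKatoTwo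

end
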